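/-
M17b (decomp-mm-lens-5 g30) — THE BOUNDED-TWIST CLASS AND THE RE-TYPED RESIDUAL OF RUNG `K = 2`.
Pairs `(E, y)` flattened by `≤ T₀` translates of support `≤ s₀` (BOUNDED TWIST) deflate at cost
`≤ 4·((T₀+1)·cost E + 4·n·s₀·T₀) + n²` modulo the routine plumbing statement `TranslatesPlumbing`;
the residual of hand 1 shrinks to the UNBOUNDED-TWIST class (weaker than `HiddenTwistedCorrDeflation`),
NEC in the window, and the assembly closes rung `2` from plumbing + the windowed residual.  No sorry.
-/
import Mathlib
import Summits.MatrixMultiplication.Statement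
import Summits.MatrixMultiplication.MatrixMultiplication.Theorems.GraphEquationsCorrectedAD
import Summits.MatrixMultiplication.MatrixMultiplication.Theorems.GraphEquationsUntwisting

/-!
# Graph equations — the bounded-twist class and the unbounded-twist residual

Supporting kernels for the crux `MultiplicityReduction` of route `GraphEquations`
(line `purisplit`, stub `BoundedOrderPurification`, rung `K = 2`:
`EqAdmissibleIdealIso β 2 → EqAdmissiblePure β'` for `2 ≤ β < β'`).

M17a (`GraphEquationsUntwisting`) shows that adjoining finitely many TRANSLATES `t ∘ τ_δ` of the
tests (a free symmetry of the graph: no kernel field, no correction) makes any order-`2` pair flat,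
hence const-deflatable; `≤ n²` translates always suffice.  The only price is the COST of a
translate: a copy of `E` run on translated inputs, `cost E + O(n · #supp δ)`.  This file types

* **`TranslatesPlumbing`** (named statement, ROUTINE circuit plumbing — the analogue of
  `ForwardModeAD` / `CorrectedForwardModeAD`, to be discharged by a construction like
  `forwardModeAD`): from a fan-in-two `E` and a list `Δ` of translations of support `≤ s`, a
  fan-in-two system realising exactly the tests of `E` and their `Δ`-translates
  (`EqSystem.TranslatesTo`), of cost `≤ (|Δ|+1)·cost E + 4·n·s·|Δ|` (per translate
  `δ = Σ_{v ∈ supp δ} δ_v e_v`, composed of ELEMENTARY translates: for each `v ∈ supp δ` one input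
  gate `a_v + δ_v` and `n` fan-in-two gates `c_{il} + δ_v·b_{kl}` (resp. `c_{il} + δ_v·a_{ik}`), i.e.
  `(n+1)·|supp δ|` gates, then ONE substituted copy of the gates of `E`).
* **The BOUNDED-TWIST class** (`EqSystem.BoundedTwist T₀ s₀ E y`): some list of `≤ T₀` translations,
  each of support `≤ s₀`, flattens `E` over `y`.  It contains the flat class (`T₀ = 0`,
  `boundedTwist_zero_iff_flatAt`), is monotone in `(T₀, s₀)`, contains EVERY pair once
  `n² ≤ T₀ ∧ 2n² ≤ s₀` (`boundedTwist_of_le`, by finite flattening — so the residual below is a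
  statement about GROWTH in `n`, vacuous at each fixed small `n`), and contains the hidden ∧ twisted
  example of M16a and the non-row-split toy of the g29 critic (one translate of support `1` each,
  see M17a).  **It deflates** (`exists_reduced_deflation_of_boundedTwist`): modulo
  `TranslatesPlumbing`, a correct bounded-twist order-`2` pair has a correct deflation reduced at
  `graphPoint y` of cost `≤ 4·((T₀+1)·cost E + 4·n·s₀·T₀) + n²` — linear in `cost E` for fixed
  `(T₀, s₀)`, so it never leaves the exponent window.
* **The residual, re-typed** (`UnboundedTwistCorrDeflation K₀ T₀ s₀ β β'`, UNDECIDED): the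
  corrected demand of `HiddenTwistedCorrDeflation K₀ β β'` (a cheap tangent-deflating pair
  `(μ, ρ)` over some base pair `y'`) restricted FURTHER to pairs that are NOT of bounded twist
  `(T₀, s₀)`.  WEAKER than the g29 residual (`HiddenTwistedCorrDeflation.unboundedTwist`), antitone
  in `K₀` and in `(T₀, s₀)` (`UnboundedTwistCorrDeflation.mono_order`, `.mono_twist`), NEC in the
  window `β' ≤ ω` (`nec_unboundedTwistCorrDeflation_window` — VACUOUSLY: under `S` the window is
  empty; outside the window nothing is claimed), and SUFFICIENT:
* **ASSEMBLY** (`boundedOrderPurification_two_of_untwisting`): `TranslatesPlumbing` and the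
  windowed residual ALONE give rung `2` of BOP′ (cases per `n`: above `ω` / test-isolated /
  const-deflatable / row-split / bounded twist / residual; uniform order `2·max K₀ 1`;
  `CorrectedForwardModeAD` is the tree theorem `correctedForwardModeAD`).  NEC check of the split:
  `nec_boundedOrderPurification_two_untwisting`.

What remains outside every closed class is a pair whose twist needs UNBOUNDEDLY MANY or DENSE
translates as `n → ∞` — e.g. rows of twist rank `≍ n²` (`t = h·x(a)ᵀ F y(b) + q`): there the
translation move costs `n² · cost E`, and only a genuinely `c`-dependent kernel field (reverse-mode
gradients, next carving) or a moving base pair can be cheap.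

References: BCS97 Problem 16.3 (verification complexity of matrix multiplication); Künnemann 2018
(arXiv:1806.09189, p. 3: no deterministic verification faster than multiplication is known — why the
residual is posed only in the window `β' ≤ ω`).
-/

-- dupNamespace: forced by the nested Summit.MatrixMultiplication.MatrixMultiplication layout (D-0017)
set_option linter.dupNamespace false

noncomputable section

open scoped BigOperators

namespace Summit.MatrixMultiplication.MatrixMultiplication.Theorems.GraphEquations

open MvPolynomial Literature.Computability.AlgebraicComplexity
open Literature.Computability.AlgebraicComplexity.ArithCircuit

variable {n : ℕ}

/-! ## The plumbing statement -/

/-- **`TranslatesPlumbing`** (named statement; circuit plumbing, ROUTINE — the analogue of the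
theorems `forwardModeAD` / `correctedForwardModeAD`).  From a fan-in-two system `E` and a list `Δ`
of base translations each supported on `≤ s` entries, there is a fan-in-two system whose tests are
exactly the tests of `E` and their `Δ`-translates, of cost `≤ (|Δ| + 1)·cost E + 4·n·s·|Δ|`
(per translate `δ`, written as a composite of the elementary translates `δ_v e_v`, `v ∈ supp δ`:
one input gate `a_v + δ_v` and `n` fan-in-two gates `c_{il} + δ_v·b_{kl}` (resp. `c_{il} + δ_v·a_{ik}`)
per `v`, i.e. `(n+1)·|supp δ| ≤ 2·n·s` gates for `n ≥ 1`; then one substituted copy of the gates of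
`E` reading the translated inputs — Bürgisser 2000, Rem. 2.7, `ArithCircuit.substCircuit`). -/
def TranslatesPlumbing : Prop :=
  ∀ (n : ℕ) (E : EqSystem n) (Δ : List (MatMulVars n → ℂ)) (s : ℕ),
    E.circuit.IsFanInTwo → (∀ δ ∈ Δ, (Function.support δ).ncard ≤ s) →
    ∃ E' : EqSystem n, E'.circuit.IsFanInTwo ∧ E.TranslatesTo Δ E' ∧
      E'.cost ≤ (Δ.length + 1) * E.cost + 4 * n * s * Δ.length

namespace EqSystem

/-! ## The bounded-twist class -/

/-- **BOUNDED TWIST `(T₀, s₀)` over `y`**: some list of at most `T₀` base translations, each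
supported on at most `s₀` entries of `(A, B)`, flattens `E` over `y`
(`N(y) ∩ ⋂_{δ ∈ Δ} N(y + δ) = ` the global tangent space). -/
def BoundedTwist (T₀ s₀ : ℕ) (E : EqSystem n) (y : MatMulVars n → ℂ) : Prop :=
  ∃ Δ : List (MatMulVars n → ℂ), Δ.length ≤ T₀ ∧ (∀ δ ∈ Δ, (Function.support δ).ncard ≤ s₀) ∧
    E.Flattens y Δ

/-- Twist `(0, s₀)` is flatness. -/
theorem boundedTwist_zero_iff_flatAt (s₀ : ℕ) (E : EqSystem n) (y : MatMulVars n → ℂ) :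
    E.BoundedTwist 0 s₀ y ↔ E.FlatAt y := by
  constructor
  · rintro ⟨Δ, hlen, -, hflat⟩
    obtain rfl : Δ = [] := List.eq_nil_of_length_eq_zero (Nat.le_zero.mp hlen)
    exact (E.flattens_nil_iff y).mp hflat
  · exact fun h => ⟨[], le_rfl, fun _ hδ => by simp at hδ, (E.flattens_nil_iff y).mpr h⟩

/-- Flat pairs have bounded twist for every `(T₀, s₀)`. -/
theorem FlatAt.boundedTwist {E : EqSystem n} {y : MatMulVars n → ℂ} (h : E.FlatAt y) (T₀ s₀ : ℕ) :
    E.BoundedTwist T₀ s₀ y :=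
  ⟨[], Nat.zero_le _, fun _ hδ => by simp at hδ, (E.flattens_nil_iff y).mpr h⟩

/-- Monotone in `(T₀, s₀)`. -/
theorem BoundedTwist.mono {E : EqSystem n} {y : MatMulVars n → ℂ} {T₀ s₀ T₁ s₁ : ℕ}
    (h : E.BoundedTwist T₀ s₀ y) (hT : T₀ ≤ T₁) (hs : s₀ ≤ s₁) : E.BoundedTwist T₁ s₁ y := by
  obtain ⟨Δ, hlen, hsupp, hflat⟩ := h
  exact ⟨Δ, hlen.trans hT, fun δ hδ => (hsupp δ hδ).trans hs, hflat⟩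

/-- **Every pair has bounded twist once `n² ≤ T₀` and `2n² ≤ s₀`** (finite flattening): the class is
exhaustive at each fixed `n`, so its complement is a condition on GROWTH in `n`. -/
theorem boundedTwist_of_le {T₀ s₀ : ℕ} (E : EqSystem n) (y : MatMulVars n → ℂ) (hT : n * n ≤ T₀)
    (hs : 2 * (n * n) ≤ s₀) : E.BoundedTwist T₀ s₀ y := by
  obtain ⟨Δ, hlen, hflat⟩ := E.exists_flattening y
  refine ⟨Δ, hlen.trans hT, fun δ _ => ?_, hflat⟩
  refine (Set.ncard_le_card _).trans ?_
  rw [Nat.card_eq_fintype_card, Fintype.card_sum, Fintype.card_prod, Fintype.card_fin]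
  omega

/-- **THE BOUNDED-TWIST CLASS DEFLATES** (modulo plumbing).  A correct pair `(E, y)` of bounded
twist `(T₀, s₀)` with test ideal initially isolated to order `2` over `y` has a CORRECT deflation
REDUCED at `graphPoint y` of cost `≤ 4·((T₀ + 1)·cost E + 4·n·s₀·T₀) + n²`. -/
theorem exists_reduced_deflation_of_boundedTwist (hP : TranslatesPlumbing) {T₀ s₀ : ℕ}
    {E : EqSystem n} {y : MatMulVars n → ℂ} (hE : E.Correct) (hiso : E.IdealInitIsolatedAt 2 y)
    (hB : E.BoundedTwist T₀ s₀ y) :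
    ∃ E'' : EqSystem n, E''.Correct ∧ E''.ReducedAt (graphPoint y) ∧
      E''.cost ≤ 4 * ((T₀ + 1) * E.cost + 4 * n * s₀ * T₀) + n * n := by
  obtain ⟨Δ, hlen, hsupp, hflat⟩ := hB
  obtain ⟨E', hfan', hT, hcost'⟩ := hP n E Δ s₀ hE.1 hsupp
  obtain ⟨E'', hE'', hred, hcost''⟩ := exists_reduced_deflation_of_translatesTo hE hiso hflat hfan' hT
  refine ⟨E'', hE'', hred, hcost''.trans ?_⟩
  have h1 : (Δ.length + 1) * E.cost ≤ (T₀ + 1) * E.cost := Nat.mul_le_mul_right _ (by omega)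
  have h2 : 4 * n * s₀ * Δ.length ≤ 4 * n * s₀ * T₀ := Nat.mul_le_mul_left _ hlen
  omega

end EqSystem

/-! ## The residual, re-typed: unbounded twist -/

/-- **`UnboundedTwistCorrDeflation K₀ T₀ s₀ β β'`** (UNDECIDED · the re-typed residual of rung `2`):
the corrected tangent-deflation demand of `HiddenTwistedCorrDeflation K₀ β β'` — for cost-`c·n^β`
correct pairs `(E, y)` with test ideal initially isolated to order `2` over `y` that are HIDDEN
(tests not initially isolated to order `K₀`), TWISTED (not const-deflatable), NOT ROW-SPLIT — restricted
further to pairs of UNBOUNDED TWIST: not flattened by any `≤ T₀` translates of support `≤ s₀`.  For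
those, a pair `(μ, ρ)` (kernel field, corrections) computable in `c'·n^{β'}` operations is demanded
whose corrected deflation isolates the test ideal to order `1` over some base pair `y'`. -/
def UnboundedTwistCorrDeflation (K₀ T₀ s₀ : ℕ) (β β' : ℝ) : Prop :=
  ∀ c : ℝ, ∃ c' : ℝ, ∀ n : ℕ, 1 ≤ n → ∀ (E : EqSystem n) (y : MatMulVars n → ℂ),
    E.Correct → E.IdealInitIsolatedAt 2 y → ¬ E.InitIsolatedAt K₀ y → ¬ E.ConstDeflatable y →
    ¬ E.RowSplit → ¬ E.BoundedTwist T₀ s₀ y → (E.cost : ℝ) ≤ c * (n : ℝ) ^ β →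
    ∃ (y' : MatMulVars n → ℂ) (μ : Fin n × Fin n → MvPolynomial (MatMulVars n) ℂ)
      (ρ : ℕ → MvPolynomial (MatMulVars n) ℂ) (Eμ : EqSystem n),
      Eμ.circuit.IsFanInTwo ∧
      (∀ q, ∃ i ∈ Eμ.tests, Eμ.testPoly i = liftAB n (μ q)) ∧
      (∀ j ∈ E.tests, ρ j = 0 ∨ ∃ i ∈ Eμ.tests, Eμ.testPoly i = liftAB n (ρ j)) ∧
      (Eμ.cost : ℝ) ≤ c' * (n : ℝ) ^ β' ∧
      (∀ j ∈ E.tests, derivC μ (E.testPoly j) - liftAB n (ρ j) ∈ graphIdeal n) ∧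
      (∀ E'' : EqSystem n, E.CorrDeflatesTo μ ρ E'' → E''.IdealInitIsolatedAt 1 y')

/-- **WEAKER than the g29 residual**: `HiddenTwistedCorrDeflation K₀ β β' → UnboundedTwistCorrDeflation K₀ T₀ s₀ β β'`. -/
theorem HiddenTwistedCorrDeflation.unboundedTwist {K₀ : ℕ} {β β' : ℝ}
    (h : HiddenTwistedCorrDeflation K₀ β β') (T₀ s₀ : ℕ) : UnboundedTwistCorrDeflation K₀ T₀ s₀ β β' := by
  intro c
  obtain ⟨c', hc'⟩ := h c
  exact ⟨c', fun n hn E y hE hiso htest hcd hrs _ hcost => hc' n hn E y hE hiso htest hcd hrs hcost⟩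

/-- Weaker than the kernel-field residual of M16a and than `UniformKernelFieldDeflation`. -/
theorem HiddenTwistedDeflation.unboundedTwist {K₀ : ℕ} {β β' : ℝ} (h : HiddenTwistedDeflation K₀ β β')
    (T₀ s₀ : ℕ) : UnboundedTwistCorrDeflation K₀ T₀ s₀ β β' :=
  h.corr.unboundedTwist T₀ s₀

/-- Antitone in the test-isolation order `K₀`. -/
theorem UnboundedTwistCorrDeflation.mono_order {K₀ K₁ T₀ s₀ : ℕ} {β β' : ℝ}
    (h : UnboundedTwistCorrDeflation K₀ T₀ s₀ β β') (hK : K₀ ≤ K₁) :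
    UnboundedTwistCorrDeflation K₁ T₀ s₀ β β' := by
  intro c
  obtain ⟨c', hc'⟩ := h c
  exact ⟨c', fun n hn E y hE hiso htest hcd hrs hB hcost =>
    hc' n hn E y hE hiso (fun h' => htest (h'.mono hK)) hcd hrs hB hcost⟩

/-- Antitone in the twist bounds `(T₀, s₀)`: allowing more or denser translates shrinks the residual class. -/
theorem UnboundedTwistCorrDeflation.mono_twist {K₀ T₀ s₀ T₁ s₁ : ℕ} {β β' : ℝ}
    (h : UnboundedTwistCorrDeflation K₀ T₀ s₀ β β') (hT : T₀ ≤ T₁) (hs : s₀ ≤ s₁) :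
    UnboundedTwistCorrDeflation K₀ T₁ s₁ β β' := by
  intro c
  obtain ⟨c', hc'⟩ := h c
  exact ⟨c', fun n hn E y hE hiso htest hcd hrs hB hcost =>
    hc' n hn E y hE hiso htest hcd hrs (fun h' => hB (h'.mono hT hs)) hcost⟩

/-- **NEC in the window (vacuously).**  Under `S` (`ω = 2`) the window `2 ≤ β < β' ≤ ω` is empty. -/
theorem nec_unboundedTwistCorrDeflation_window (hS : _root_.MatrixMultiplication) (K₀ T₀ s₀ : ℕ) :
    ∀ β β' : ℝ, 2 ≤ β → β < β' → β' ≤ omega ℂ → UnboundedTwistCorrDeflation K₀ T₀ s₀ β β' :=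
  fun β β' hβ hββ' hω => (nec_hiddenTwistedCorrDeflation_window hS K₀ β β' hβ hββ' hω).unboundedTwist T₀ s₀

/-! ## Assembly of `BoundedOrderPurification (K = 2)` -/

/-- **ASSEMBLY (g30).**  The two plumbing statements and the windowed unbounded-twist residual give
rung `2` of BOP′: `2 ≤ β`, `EqAdmissibleIdealIso β 2`, `β < β'` ⇒ `EqAdmissiblePure β'`.
Per `n`: above `ω` the tree rung; a test-isolated pair is pure of order `2K₀` as it stands; a
const-deflatable or row-split pair deflates at cost `4·cost + n²`; a bounded-twist pair is
translated (plumbing) and then deflates; the rest is the residual (corrected forward-mode AD).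
Uniform order `2·max K₀ 1`. -/
theorem boundedOrderPurification_two_of_untwisting_plumbing (K₀ T₀ s₀ : ℕ) (hP : TranslatesPlumbing)
    (hAD : CorrectedForwardModeAD)
    (hR : ∀ β β' : ℝ, 2 ≤ β → β < β' → β' ≤ omega ℂ → UnboundedTwistCorrDeflation K₀ T₀ s₀ β β')
    (β : ℝ) (hβ : 2 ≤ β) (hiso : EqAdmissibleIdealIso β 2) (β' : ℝ) (hββ' : β < β') :
    EqAdmissiblePure β' := by
  by_cases hω : omega ℂ < β'
  · exact eqAdmissiblePure_of_idealIso_one (eqAdmissibleIdealIso_one_of_omega_lt hω)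
  obtain ⟨c, hc⟩ := hiso
  obtain ⟨c', hc'⟩ := hR β β' hβ hββ' (not_lt.mp hω) c
  refine ⟨2 * max K₀ 1, 5 * ((T₀ : ℝ) + 1) * max c 0 + max c' 0 + 16 * (s₀ : ℝ) * T₀ + 1,
    fun n hn => ?_⟩
  obtain ⟨E, hE, ⟨y, hy⟩, hcost⟩ := hc n hn
  have hK2 : 2 ≤ 2 * max K₀ 1 := by omega
  have hn1 : (1 : ℝ) ≤ n := by exact_mod_cast hn
  have hpow : (n : ℝ) ^ β ≤ (n : ℝ) ^ β' := Real.rpow_le_rpow_of_exponent_le hn1 hββ'.le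
  have hpos : 0 ≤ (n : ℝ) ^ β := Real.rpow_nonneg (Nat.cast_nonneg n) β
  have hpos' : 0 ≤ (n : ℝ) ^ β' := Real.rpow_nonneg (Nat.cast_nonneg n) β'
  have hsq : ((n * n : ℕ) : ℝ) ≤ (n : ℝ) ^ β' := by
    rw [Nat.cast_mul, ← sq, ← Real.rpow_two]
    exact Real.rpow_le_rpow_of_exponent_le hn1 (hβ.trans hββ'.le)
  have hnle : (n : ℝ) ≤ (n : ℝ) ^ β' := by
    conv_lhs => rw [← Real.rpow_one (n : ℝ)]
    exact Real.rpow_le_rpow_of_exponent_le hn1 (by linarith)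
  have h1 : (E.cost : ℝ) ≤ max c 0 * (n : ℝ) ^ β' :=
    hcost.trans ((mul_le_mul_of_nonneg_right (le_max_left c 0) hpos).trans
      (mul_le_mul_of_nonneg_left hpow (le_max_right c 0)))
  have hc'0 : 0 ≤ max c' 0 * (n : ℝ) ^ β' := mul_nonneg (le_max_right c' 0) hpos'
  have hT0 : (0 : ℝ) ≤ T₀ := Nat.cast_nonneg T₀
  have hs0 : (0 : ℝ) ≤ s₀ := Nat.cast_nonneg s₀
  have hM0 : 0 ≤ max c 0 * (n : ℝ) ^ β' := mul_nonneg (le_max_right c 0) hpos'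
  have hA : ((T₀ : ℝ) + 1) * E.cost ≤ ((T₀ : ℝ) + 1) * (max c 0 * (n : ℝ) ^ β') :=
    mul_le_mul_of_nonneg_left h1 (by linarith)
  have hB : (n : ℝ) * s₀ * T₀ ≤ (n : ℝ) ^ β' * s₀ * T₀ :=
    mul_le_mul_of_nonneg_right (mul_le_mul_of_nonneg_right hnle hs0) hT0
  have hTM : 0 ≤ (T₀ : ℝ) * (max c 0 * (n : ℝ) ^ β') := mul_nonneg hT0 hM0
  have hsT : 0 ≤ (n : ℝ) ^ β' * s₀ * T₀ := mul_nonneg (mul_nonneg hpos' hs0) hT0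
  by_cases htest : E.InitIsolatedAt K₀ y
  · refine ⟨E, hE, htest.pureIsolated.mono (by omega), ?_⟩
    nlinarith [h1, hc'0, hpos', hTM, hsT, hM0]
  by_cases hcd : E.ConstDeflatable y
  · obtain ⟨E', hE', hred, hcostE'⟩ := EqSystem.exists_reduced_deflation_of_constDeflatable hE hcd
    refine ⟨E', hE', EqSystem.pureIsolated_of_reducedAt_graphPoint hE' hred hK2, ?_⟩
    have h3 : (E'.cost : ℝ) ≤ 4 * E.cost + (n * n : ℕ) := by exact_mod_cast hcostE'
    nlinarith [h1, h3, hsq, hc'0, hTM, hsT, hM0]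
  by_cases hrs : E.RowSplit
  · obtain ⟨E', hE', hred, hcostE'⟩ := EqSystem.exists_reduced_corrDeflation_of_rowSplit hE hy hrs
    refine ⟨E', hE', EqSystem.pureIsolated_of_reducedAt_graphPoint hE' hred hK2, ?_⟩
    have h3 : (E'.cost : ℝ) ≤ 4 * E.cost + (n * n : ℕ) := by exact_mod_cast hcostE'
    nlinarith [h1, h3, hsq, hc'0, hTM, hsT, hM0]
  by_cases hBT : E.BoundedTwist T₀ s₀ y
  · obtain ⟨E', hE', hred, hcostE'⟩ := EqSystem.exists_reduced_deflation_of_boundedTwist hP hE hy hBT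
    refine ⟨E', hE', EqSystem.pureIsolated_of_reducedAt_graphPoint hE' hred hK2, ?_⟩
    have h3 : (E'.cost : ℝ) ≤ 4 * (((T₀ : ℝ) + 1) * E.cost + 4 * (n : ℝ) * s₀ * T₀) + (n * n : ℕ) := by
      exact_mod_cast hcostE'
    nlinarith [hA, hB, h3, hsq, hc'0, hTM, hsT, hM0, hpos']
  · obtain ⟨y', μ, ρ, Eμ, hfanμ, hμ, hρ, hμcost, hI, hgood⟩ :=
      hc' n hn E y hE hy htest hcd hrs hBT hcost
    have hρ0 : ∀ j ∈ E.tests, E.testPoly j = 0 → ρ j = 0 := fun j hj h0 => by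
      have h := hI j hj
      rw [h0, derivC_zero, zero_sub, neg_mem_iff] at h
      exact MvPolynomial.funext fun x => by
        simpa only [eval_graphPoint_liftAB, map_zero] using
          eval_eq_zero_of_mem_graphIdeal h (graphPoint_mem_mmGraph x)
    obtain ⟨E', hfan', hD, htests, hcost'⟩ := hAD n E Eμ μ ρ hE.1 hfanμ hμ hρ hρ0
    have hE' : E'.Correct := hE.of_contains hfan' hD.1 fun j' hj' => by
      rcases htests j' hj' with ⟨j, hj, he⟩ | ⟨j, hj, he⟩
      · rw [he]; exact mem_graphIdeal_of_vanishing fun x hx => hE.eval_testPoly_eq_zero hx hj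
      · rw [he]; exact hI j hj
    refine ⟨E', hE', EqSystem.pureIsolated_of_reducedAt_graphPoint hE'
      (EqSystem.reducedAt_of_idealInitIsolatedAt_one hE' (hgood E' hD)) hK2, ?_⟩
    have h2 : (Eμ.cost : ℝ) ≤ max c' 0 * (n : ℝ) ^ β' :=
      hμcost.trans (mul_le_mul_of_nonneg_right (le_max_left c' 0) hpos')
    have h3 : (E'.cost : ℝ) ≤ 5 * E.cost + Eμ.cost := by exact_mod_cast hcost'
    nlinarith [h1, h2, h3, hpos', hTM, hsT, hM0]

/-- **ASSEMBLY with the corrected AD discharged** (tree theorem `correctedForwardModeAD`):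
`TranslatesPlumbing` and the windowed unbounded-twist residual ALONE give rung `2` of BOP′. -/
theorem boundedOrderPurification_two_of_untwisting (K₀ T₀ s₀ : ℕ) (hP : TranslatesPlumbing)
    (hR : ∀ β β' : ℝ, 2 ≤ β → β < β' → β' ≤ omega ℂ → UnboundedTwistCorrDeflation K₀ T₀ s₀ β β')
    (β : ℝ) (hβ : 2 ≤ β) (hiso : EqAdmissibleIdealIso β 2) (β' : ℝ) (hββ' : β < β') :
    EqAdmissiblePure β' :=
  boundedOrderPurification_two_of_untwisting_plumbing K₀ T₀ s₀ hP correctedForwardModeAD hR β hβ hiso β' hββ'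

/-- The same assembly from the UNWINDOWED residual. -/
theorem boundedOrderPurification_two_of_untwisting' (K₀ T₀ s₀ : ℕ) (hP : TranslatesPlumbing)
    (hR : ∀ β β' : ℝ, 2 ≤ β → β < β' → UnboundedTwistCorrDeflation K₀ T₀ s₀ β β')
    (β : ℝ) (hβ : 2 ≤ β) (hiso : EqAdmissibleIdealIso β 2) (β' : ℝ) (hββ' : β < β') :
    EqAdmissiblePure β' :=
  boundedOrderPurification_two_of_untwisting K₀ T₀ s₀ hP (fun β β' hβ hββ' _ => hR β β' hβ hββ')
    β hβ hiso β' hββ'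

/-- **Under `S` (and the plumbing) rung `2` of BOP′ holds** — NEC check of the untwisting split. -/
theorem nec_boundedOrderPurification_two_untwisting (hS : _root_.MatrixMultiplication)
    (hP : TranslatesPlumbing) (β : ℝ) (hβ : 2 ≤ β) (hiso : EqAdmissibleIdealIso β 2) (β' : ℝ)
    (hββ' : β < β') : EqAdmissiblePure β' :=
  boundedOrderPurification_two_of_untwisting 0 0 0 hP (nec_unboundedTwistCorrDeflation_window hS 0 0 0)
    β hβ hiso β' hββ'

end Summit.MatrixMultiplication.MatrixMultiplication.Theorems.GraphEquations

end
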